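import Mathlib
import Summits.RiemannHypothesis.RiemannHypothesis.Theorems.WeilFarFloorCoshSplitRH
import HarnessLib

/-!
# Under RH: the `O(1)` ceiling of the prime-shift form on every linear-modulus class

Helper file (`--supports stmt-RiemannHypothesis-0098`, lead-track anchor: Weil-positivity window ladder, format-C far bound),
pure proofs.  Seat rh-explicit-weil-1 gen12 (memo `run/shared/lean/pub/rh-explicit/rh-explicit-weil-1/FORMAT-K3.md` §13); sequel of
`WeilFarFloorCoshSplitRH` (the split of the RH anatomy along the cosh profile).

THE THEOREM (`primeShiftForm_le_of_RH_of_linearModulus`).  Assume RH.  Let `b > 0`, `0 < h ≤ 1`, `θ, η ∈ (0, 1]`, `δ > 0`, `A ≥ 0`, and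
suppose (i) the window is large against the cut `t₀ = θh`: `4(1 + δ)Ψ(θh) ≤ 2(b + sinh b)` (`Ψ = weilArchTail ≤ ½ log(1/(θh)) + 2`), and
(ii) the cosh profiles `C_{b'} = cosh(·/2)·1_{[−b',b']}`, `b' ∈ [b, b + h]`, have archimedean energy `∫_{(θh,∞)} ρ_∞ D_t(C_{b'}) ≤ A(b' + sinh b')`
(`A = 2I₀` for `b ≥ 4`, `WeilFarFloorCoshProfileEnergy`).  Then EVERY real measurable bounded `G` vanishing off `[−b, b]` in the
LINEAR-MODULUS CLASS `∫ (G(x+t) − G(x))² dx ≤ (|t|/h)·∫G²` satisfies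

  **`Q_b(G) ≤ (2((b + h) + sinh(b + h)) + (1 + 1/δ)A − (2I₀ + log 4π + γ) + θ + η)·∫G²`.**

The modulus scale `h` enters only through (i) — `h ≥ exp(−e^b/(5(1 + δ)))` is enough — and NOT through a `log(1/h)` loss (compare the
gen11 envelope ceiling `2((b+2h) + sinh(b+2h)) − K + log(2/h) + 6`).  PROOF: mollify `G` by the bump of radius `ε ≤ η²h/8`
(`WeilFarFloorWindowSmoothing`: a Weil test on `[−(b+ε), b+ε]`, `∫G_ε² ≤ ∫G²`, `D_t(G_ε) ≤ D_t(G)`, `‖G_ε − G‖₂² ≤ 2ε∫G²/h`), apply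
`FloorCoshSplit.primeShiftForm_le_of_RH_split` to `G_ε` with the small-scale budget `∫_{(0,θh]} ρ_∞ (t/h)∫G² ≤ θ∫G²`
(`FloorEnvelope.archBudget_small`), and return to `G` by the `L²`-Lipschitz bound of `Q` (`WeilFarFloorShiftFormLipschitz`); `ε` is chosen so
that all mollification errors are `≤ η∫G²`.  Applied to the RMS envelopes of `WeilFarFloorEnvelope` (`h ≍ e^{−a}`) this is the floor law
C-XIII under RH with the sharp constant (sequel).  Standard axioms only; RH enters as Mathlib's `RiemannHypothesis`.
-/

set_option linter.dupNamespace false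
set_option autoImplicit false

noncomputable section

open MeasureTheory Set Filter
open scoped Real Topology ArithmeticFunction.vonMangoldt

namespace Summit.RiemannHypothesis.RiemannHypothesis.Theorems.WeilFormatC

namespace FloorCoshSplit

open Literature.NumberTheory.LFunctions FloorSmoothing FloorCosh FloorEnvelope

/-- The killing constant `2I₀ + log 4π + γ` is nonnegative. -/
theorem killingConstant_nonneg :
    0 ≤ 2 * (∫ t in Ioi (0 : ℝ), (Real.exp (t / 2) - 1) / (2 * Real.sinh t))
      + (Real.log (4 * π) + Real.eulerMascheroniConstant) := by
  have h1 : 0 ≤ ∫ t in Ioi (0 : ℝ), (Real.exp (t / 2) - 1) / (2 * Real.sinh t) :=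
    setIntegral_nonneg measurableSet_Ioi fun t ht ↦ weilKillingDensity_nonneg ht
  have h2 : 0 ≤ Real.log (4 * π) := Real.log_nonneg (by linarith [Real.pi_gt_three])
  have h3 := Real.one_half_lt_eulerMascheroniConstant
  linarith

/-- **Smooth approximants inside a linear-modulus class.**  For an admissible `G` on `[−b, b]` with `∫(G(x+t) − G(x))² ≤ (|t|/h)∫G²`
and `ε > 0`, the bump average `G_ε` is a real Weil test supported in `[−(b+ε), b+ε]`, admissible with the same bound, with
`∫G_ε² ≤ ∫G²`, the same increment budget, and `∫(G_ε − G)² ≤ (2ε/h)∫G²` (`WeilFarFloorWindowSmoothing`). -/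
theorem exists_weilTest_near_of_linearModulus {b h : ℝ} (hh0 : 0 < h) {G : ℝ → ℝ} {CG : ℝ} (hGm : Measurable G)
    (hGb : ∀ x, |G x| ≤ CG) (hGs : ∀ x, x ∉ Icc (-b) b → G x = 0)
    (hmod : ∀ t, ∫ x, (G (x + t) - G x) ^ 2 ≤ |t| / h * ∫ x, G x ^ 2) {ε : ℝ} (hε0 : 0 < ε) :
    ∃ u : ℝ → ℝ, IsWeilTest (fun x ↦ (u x : ℂ)) ∧ tsupport (fun x ↦ (u x : ℂ)) ⊆ Icc (-(b + ε)) (b + ε) ∧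
      Measurable u ∧ (∀ x, |u x| ≤ CG) ∧ (∀ x, x ∉ Icc (-(b + ε)) (b + ε) → u x = 0) ∧
      (∫ x, u x ^ 2 ≤ ∫ x, G x ^ 2) ∧ (∀ t, ∫ x, (u (x + t) - u x) ^ 2 ≤ |t| / h * ∫ x, G x ^ 2) ∧
      ∫ x, (u x - G x) ^ 2 ≤ 2 * ε / h * ∫ x, G x ^ 2 := by
  have hN : 0 ≤ ∫ x, G x ^ 2 := integral_nonneg fun x ↦ sq_nonneg _
  obtain ⟨hψm, hψ0, hψC, hψs, hψ1⟩ := bump_weight hε0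
  set ψ : ℝ → ℝ := fun y ↦ (⟨ε / 2, ε, by positivity, by linarith⟩ : ContDiffBump (0 : ℝ)).normed volume y with hψdef
  set Gε : ℝ → ℝ := fun x ↦ ∫ y, ψ y * G (x - y) with hGεdef
  obtain ⟨hGεm, hGεb, hGεs⟩ : Measurable Gε ∧ (∀ x, |Gε x| ≤ CG) ∧ (∀ x, x ∉ Icc (-(b + ε)) (b + ε) → Gε x = 0) :=
    smoothed_admissible hGm hGb hGs hψm hψ0 hψs hψ1
  have hWT : IsWeilTest fun x ↦ ((Gε x : ℝ) : ℂ) := isWeilTest_smoothed hε0 hGm hGb hGs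
  have hTS : tsupport (fun x ↦ ((Gε x : ℝ) : ℂ)) ⊆ Icc (-(b + ε)) (b + ε) := tsupport_smoothed_subset hε0 hGm hGb hGs
  have hGεN : ∫ x, Gε x ^ 2 ≤ ∫ x, G x ^ 2 := integral_smoothed_sq_le hGm hGb hGs hψm hψ0 hψC hψs hψ1
  have hdist : ∫ x, (Gε x - G x) ^ 2 ≤ 2 * ε / h * ∫ x, G x ^ 2 := by
    refine integral_sq_smoothed_sub_le hGm hGb hGs hψm hψ0 hψC hψs hψ1 fun y hy ↦ ?_
    have h1 := hmod (-y)
    have e : ∫ x, (G (x - y) - G x) ^ 2 = ∫ x, (G (x + -y) - G x) ^ 2 := by simp only [← sub_eq_add_neg]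
    rw [e]
    refine h1.trans (mul_le_mul_of_nonneg_right ?_ hN)
    rw [abs_neg]
    have : |y| ≤ ε := abs_le.2 ⟨hy.1, hy.2⟩
    rw [div_le_div_iff₀ hh0 hh0]
    have h' := mul_le_mul_of_nonneg_right this hh0.le
    nlinarith only [h', hε0, hh0]
  have hinc : ∀ t, ∫ x, (Gε (x + t) - Gε x) ^ 2 ≤ |t| / h * ∫ x, G x ^ 2 := fun t ↦
    (integral_sq_smoothed_sub_smoothed_le hGm hGb hGs hψm hψ0 hψC hψs hψ1 t).trans (hmod t)
  exact ⟨Gε, hWT, hTS, hGεm, hGεb, hGεs, hGεN, hinc, hdist⟩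

/-- **UNDER RH: THE `O(1)` CEILING ON A LINEAR-MODULUS CLASS.**  See the file header: for an admissible `G` on `[−b, b]` with
`∫(G(x+t) − G(x))² ≤ (|t|/h)∫G²`, under the largeness condition `4(1+δ)Ψ(θh) ≤ 2(b + sinh b)` and a cosh-profile energy budget `A` on
`[b, b+h]`, `Q_b(G) ≤ (2((b+h) + sinh(b+h)) + (1 + 1/δ)A − (2I₀ + log 4π + γ) + θ + η)·∫G²`. -/
theorem primeShiftForm_le_of_RH_of_linearModulus (hRH : RiemannHypothesis) {b h θ δ η A : ℝ}
    (hb : 0 < b) (hh0 : 0 < h) (hh1 : h ≤ 1) (hθ0 : 0 < θ) (hθ1 : θ ≤ 1) (hδ : 0 < δ) (hη0 : 0 < η) (hη1 : η ≤ 1)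
    (hA0 : 0 ≤ A) (hbig : 4 * (1 + δ) * weilArchTail (θ * h) ≤ 2 * (b + Real.sinh b))
    (hA : ∀ b' ∈ Icc b (b + h),
      IntegrableOn (fun t ↦ weilArchDensity t
          * ∫ x, ((Icc (-b') b').indicator (fun y ↦ Real.cosh (y / 2)) (x + t)
              - (Icc (-b') b').indicator (fun y ↦ Real.cosh (y / 2)) x) ^ 2) (Ioi (θ * h)) ∧
        ∫ t in Ioi (θ * h), weilArchDensity t
            * ∫ x, ((Icc (-b') b').indicator (fun y ↦ Real.cosh (y / 2)) (x + t)
                - (Icc (-b') b').indicator (fun y ↦ Real.cosh (y / 2)) x) ^ 2 ≤ A * (b' + Real.sinh b'))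
    {G : ℝ → ℝ} {CG : ℝ} (hGm : Measurable G) (hGb : ∀ x, |G x| ≤ CG) (hGs : ∀ x, x ∉ Icc (-b) b → G x = 0)
    (hmod : ∀ t, ∫ x, (G (x + t) - G x) ^ 2 ≤ |t| / h * ∫ x, G x ^ 2) :
    primeShiftForm b G
      ≤ (2 * ((b + h) + Real.sinh (b + h)) + (1 + 1 / δ) * A
          - (2 * (∫ t in Ioi (0 : ℝ), (Real.exp (t / 2) - 1) / (2 * Real.sinh t))
              + (Real.log (4 * π) + Real.eulerMascheroniConstant))
          + θ + η) * ∫ x, G x ^ 2 := by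
  classical
  set N := ∫ x, G x ^ 2 with hNdef
  have hN : 0 ≤ N := integral_nonneg fun x ↦ sq_nonneg _
  set K := 2 * (∫ t in Ioi (0 : ℝ), (Real.exp (t / 2) - 1) / (2 * Real.sinh t))
      + (Real.log (4 * π) + Real.eulerMascheroniConstant) with hKdef
  have hK0 : 0 ≤ K := killingConstant_nonneg
  -- the weight sum of the big window and the choice of `ε`
  set W := ∑ n ∈ weilPrimeIndex (b + 1), 2 * ((Λ n : ℝ) / Real.sqrt n) with hWdef
  have hW0 : 0 ≤ W := Finset.sum_nonneg fun n _ ↦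
    mul_nonneg (by norm_num) (div_nonneg ArithmeticFunction.vonMangoldt_nonneg (Real.sqrt_nonneg _))
  set ε := η ^ 2 * h / (8 * (W + K + 1) ^ 2) with hεdef
  have hWK1 : 1 ≤ W + K + 1 := by linarith
  have hε0 : 0 < ε := by rw [hεdef]; positivity
  have hεh : ε ≤ h / 8 := by
    have hsq1 : (8 : ℝ) ≤ 8 * (W + K + 1) ^ 2 := by nlinarith
    have hη2 : η ^ 2 * h ≤ h := by
      have hη' : η ^ 2 ≤ 1 := by nlinarith
      nlinarith [mul_le_mul_of_nonneg_right hη' hh0.le]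
    rw [hεdef]
    calc η ^ 2 * h / (8 * (W + K + 1) ^ 2) ≤ h / (8 * (W + K + 1) ^ 2) :=
          div_le_div_of_nonneg_right hη2 (by positivity)
      _ ≤ h / 8 := div_le_div_of_nonneg_left hh0.le (by norm_num) hsq1
  set b₂ := b + ε with hb₂
  have hb₂pos : 0 < b₂ := by rw [hb₂]; linarith only [hb, hε0]
  have hb₂mem : b₂ ∈ Icc b (b + h) := ⟨by rw [hb₂]; linarith only [hε0], by rw [hb₂]; linarith only [hεh, hh0]⟩
  -- the smooth approximant `Gε`
  obtain ⟨Gε, hWT, hTS', hGεm, hGεb, hGεs', hGεN', hinc', hdist'⟩ :=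
    exists_weilTest_near_of_linearModulus hh0 hGm hGb hGs hmod hε0
  have hTS : tsupport (fun x ↦ ((Gε x : ℝ) : ℂ)) ⊆ Icc (-b₂) b₂ := by rw [hb₂]; exact hTS'
  have hGεs : ∀ x, x ∉ Icc (-b₂) b₂ → Gε x = 0 := by rw [hb₂]; exact hGεs'
  have hGεN : ∫ x, Gε x ^ 2 ≤ N := by rw [hNdef]; exact hGεN'
  have hinc : ∀ t, ∫ x, (Gε (x + t) - Gε x) ^ 2 ≤ |t| / h * N := by rw [hNdef]; exact hinc'
  have hdist : ∫ x, (Gε x - G x) ^ 2 ≤ 2 * ε / h * N := by rw [hNdef]; exact hdist'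
  -- the small-scale budget `B₀ = θN` on `(0, θh]`
  set t₀ := θ * h with ht₀def
  have ht₀ : 0 < t₀ := by positivity
  have ht₀1 : t₀ ≤ 1 := by
    rw [ht₀def]
    calc θ * h ≤ 1 * 1 := mul_le_mul hθ1 hh1 hh0.le zero_le_one
      _ = 1 := one_mul 1
  have hincC : ∀ t, weilIncrement (fun x ↦ ((Gε x : ℝ) : ℂ)) t = ∫ x, (Gε (x + t) - Gε x) ^ 2 := fun t ↦ by
    unfold weilIncrement
    exact integral_congr_ae (Eventually.of_forall fun x ↦ by
      simp only [← Complex.ofReal_sub, Complex.norm_real, Real.norm_eq_abs, sq_abs])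
  have hAi : IntegrableOn (fun t ↦ weilArchDensity t * ∫ x, (Gε (x + t) - Gε x) ^ 2) (Ioc 0 t₀) :=
    ((integrableOn_weilArchDensity_mul_weilIncrement hWT).congr_fun (fun t _ ↦ by simp only [hincC])
      measurableSet_Ioi).mono_set Ioc_subset_Ioi_self
  have hB₀ : ∫ t in Ioc 0 t₀, weilArchDensity t * ∫ x, (Gε (x + t) - Gε x) ^ 2 ≤ θ * N := by
    obtain ⟨hi, hle⟩ := archBudget_small (h := t₀) (N := θ * N) ht₀ ht₀1 (by positivity)
    refine le_trans (setIntegral_mono_on hAi hi measurableSet_Ioc fun t ht ↦ ?_) hle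
    refine mul_le_mul_of_nonneg_left ?_ (weilArchDensity_pos ht.1).le
    have h1 : ∫ x, (Gε (x + t) - Gε x) ^ 2 ≤ t / h * N := by
      have := hinc t; rwa [abs_of_pos ht.1] at this
    have h2 : t / h * N = t / t₀ * (θ * N) := by rw [ht₀def]; field_simp
    have h3 : t / h * N ≤ 2 * (θ * N) := by
      have : t / h ≤ θ := by rw [div_le_iff₀ hh0]; rw [ht₀def] at ht; exact ht.2
      have h4 := mul_le_mul_of_nonneg_right this hN
      have h5 : 0 ≤ θ * N := by positivity
      linarith only [h4, h5]
    exact h1.trans (le_min h3 (le_of_eq h2))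
  -- the split ceiling for `Gε` on the window `b₂`
  have hbig₂ : 4 * (1 + δ) * weilArchTail t₀ ≤ 2 * (b₂ + Real.sinh b₂) := by
    have h1 : b + Real.sinh b ≤ b₂ + Real.sinh b₂ := add_le_add hb₂mem.1 (Real.sinh_le_sinh.2 hb₂mem.1)
    rw [ht₀def]; linarith only [h1, hbig]
  obtain ⟨hCint, hAb₂⟩ := hA b₂ hb₂mem
  have hceil := primeShiftForm_le_of_RH_split hRH hb₂pos hWT hTS hδ ht₀ hA0 hbig₂ hB₀ hCint hAb₂
  rw [← hKdef] at hceil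
  clear_value N b₂ t₀
  -- comparison `Q_{b₂}(G)` vs `Q_{b₂}(Gε)` and `∫Gε²` vs `N`
  have hGs₂ : ∀ x, x ∉ Icc (-b₂) b₂ → G x = 0 := fun x hx ↦ hGs x fun hm ↦ hx
    ⟨by rw [hb₂]; linarith only [hm.1, hε0], by rw [hb₂]; linarith only [hm.2, hε0]⟩
  have hsqrt_dist : Real.sqrt (∫ x, (G x - Gε x) ^ 2) ≤ Real.sqrt (2 * ε / h * N) := by
    refine Real.sqrt_le_sqrt ?_
    have e : ∫ x, (G x - Gε x) ^ 2 = ∫ x, (Gε x - G x) ^ 2 :=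
      integral_congr_ae (Eventually.of_forall fun x ↦ by simp only; ring)
    rw [e]; exact hdist
  have hnormGε : Real.sqrt (∫ x, Gε x ^ 2) ≤ Real.sqrt N := Real.sqrt_le_sqrt hGεN
  have hW₂ : (∑ n ∈ weilPrimeIndex b₂, 2 * ((Λ n : ℝ) / Real.sqrt n)) ≤ W := by
    refine Finset.sum_le_sum_of_subset_of_nonneg (fun n hn ↦
      mem_weilPrimeIndex.2 ((mem_weilPrimeIndex.1 hn).trans_le (by rw [hb₂]; linarith only [hεh, hh1]))) fun n _ _ ↦
      mul_nonneg (by norm_num) (div_nonneg ArithmeticFunction.vonMangoldt_nonneg (Real.sqrt_nonneg _))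
  -- `√(2εN/h)·2√N = ηN/(W+K+1)` by the choice of `ε`
  have hεkey : Real.sqrt (2 * ε / h * N) * (2 * Real.sqrt N) = η * N / (W + K + 1) := by
    have hne : W + K + 1 ≠ 0 := by positivity
    have e1 : 2 * ε / h * N = (η / (2 * (W + K + 1))) ^ 2 * N := by
      rw [hεdef]; field_simp; ring
    rw [e1, Real.sqrt_mul (sq_nonneg _), Real.sqrt_sq (by positivity : (0 : ℝ) ≤ η / (2 * (W + K + 1)))]
    have hNN : Real.sqrt N * Real.sqrt N = N := Real.mul_self_sqrt hN
    calc η / (2 * (W + K + 1)) * Real.sqrt N * (2 * Real.sqrt N)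
        = η * (Real.sqrt N * Real.sqrt N) / (W + K + 1) := by field_simp
      _ = η * N / (W + K + 1) := by rw [hNN]
  have hpair : Real.sqrt (∫ x, (G x - Gε x) ^ 2) * (Real.sqrt (∫ x, G x ^ 2) + Real.sqrt (∫ x, Gε x ^ 2))
      ≤ η * N / (W + K + 1) := by
    calc Real.sqrt (∫ x, (G x - Gε x) ^ 2) * (Real.sqrt (∫ x, G x ^ 2) + Real.sqrt (∫ x, Gε x ^ 2))
        ≤ Real.sqrt (2 * ε / h * N) * (2 * Real.sqrt N) := by
          refine mul_le_mul hsqrt_dist (by rw [← hNdef]; linarith [hnormGε])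
            (add_nonneg (Real.sqrt_nonneg _) (Real.sqrt_nonneg _)) (Real.sqrt_nonneg _)
      _ = η * N / (W + K + 1) := hεkey
  have hLip : |primeShiftForm b₂ G - primeShiftForm b₂ Gε| ≤ W * (η * N / (W + K + 1)) :=
    (abs_primeShiftForm_sub_le (a := b₂) hGm hGεm hGb hGεb hGs₂ hGεs).trans
      (mul_le_mul hW₂ hpair (mul_nonneg (Real.sqrt_nonneg _) (add_nonneg (Real.sqrt_nonneg _) (Real.sqrt_nonneg _))) hW0)
  have hsq : |N - ∫ x, Gε x ^ 2| ≤ η * N / (W + K + 1) := by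
    have h1 := abs_integral_shift_mul_sub_le (a := b₂) hGm hGεm hGb hGεb hGs₂ hGεs 0
    simp only [sub_zero] at h1
    have e1 : ∫ x, G x * G x = N := by rw [hNdef]; exact integral_congr_ae (Eventually.of_forall fun x ↦ by ring)
    have e2 : ∫ x, Gε x * Gε x = ∫ x, Gε x ^ 2 := integral_congr_ae (Eventually.of_forall fun x ↦ by ring)
    rw [e1, e2] at h1
    exact h1.trans hpair
  -- bookkeeping
  have herr : W * (η * N / (W + K + 1)) + K * (η * N / (W + K + 1)) ≤ η * N := by
    have e : W * (η * N / (W + K + 1)) + K * (η * N / (W + K + 1)) = η * N * ((W + K) / (W + K + 1)) := by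
      field_simp
    rw [e]
    have h1 : (W + K) / (W + K + 1) ≤ 1 := by rw [div_le_one (by positivity)]; linarith only
    have hηN : 0 ≤ η * N := by positivity
    calc η * N * ((W + K) / (W + K + 1)) ≤ η * N * 1 := mul_le_mul_of_nonneg_left h1 hηN
      _ = η * N := mul_one _
  have hQ2 : primeShiftForm b G = primeShiftForm b₂ G :=
    primeShiftForm_eq_of_le (a := b) (a' := b₂) (by rw [hb₂]; linarith only [hε0]) hGs
  have hP₂ : b₂ + Real.sinh b₂ ≤ (b + h) + Real.sinh (b + h) := add_le_add hb₂mem.2 (Real.sinh_le_sinh.2 hb₂mem.2)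
  have hP₂0 : 0 ≤ b₂ + Real.sinh b₂ := by have := Real.sinh_pos_iff.2 hb₂pos; linarith only [this, hb₂pos]
  have hδ' : 0 ≤ 1 + 1 / δ := by positivity
  have hpos : 0 ≤ 2 * (b₂ + Real.sinh b₂) + (1 + 1 / δ) * A := by
    have := mul_nonneg hδ' hA0; linarith only [this, hP₂0]
  have hdiff := (abs_sub_le_iff.1 hLip).1
  have hsqd := (abs_sub_le_iff.1 hsq).1
  have hmain : (2 * (b₂ + Real.sinh b₂) + (1 + 1 / δ) * A) * (∫ x, Gε x ^ 2)
      ≤ (2 * ((b + h) + Real.sinh (b + h)) + (1 + 1 / δ) * A) * N := by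
    have h1 : (2 * (b₂ + Real.sinh b₂) + (1 + 1 / δ) * A) * (∫ x, Gε x ^ 2)
        ≤ (2 * (b₂ + Real.sinh b₂) + (1 + 1 / δ) * A) * N := mul_le_mul_of_nonneg_left hGεN hpos
    have h2' : 2 * (b₂ + Real.sinh b₂) + (1 + 1 / δ) * A ≤ 2 * ((b + h) + Real.sinh (b + h)) + (1 + 1 / δ) * A := by
      linarith only [hP₂]
    have h2 : (2 * (b₂ + Real.sinh b₂) + (1 + 1 / δ) * A) * N
        ≤ (2 * ((b + h) + Real.sinh (b + h)) + (1 + 1 / δ) * A) * N := mul_le_mul_of_nonneg_right h2' hN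
    linarith only [h1, h2]
  have hKN : -(K * ∫ x, Gε x ^ 2) ≤ -(K * N) + K * (η * N / (W + K + 1)) := by
    have := mul_le_mul_of_nonneg_left hsqd hK0
    linarith only [this]
  rw [hQ2]
  linarith only [hceil, hmain, hKN, hdiff, herr]

end FloorCoshSplit

end Summit.RiemannHypothesis.RiemannHypothesis.Theorems.WeilFormatC
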